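import Mathlib

/-!
# Polynomial germs realising resonant incoming stagnation points of self-similar Euler profiles

Solo seat `solo-NavierStokesRegularity-informed` (session 8; note `paper/incoming-stagnation.md` §4c,
EXAMPLE E). Context: for a self-similar Euler profile `(U, P)` with collapse rate `0 < γ < 1/2`,
    `(1 - γ) U + γ (y·∇) U + (U·∇) U + ∇P = 0`, `div U = 0`,                                    (PE)
Theorem A′ (`incomingRate_le_of_kelvin_stretching`) and Theorem B (`resonance_forces_incoming`) force a
node `y*` of the similarity velocity `V = γ y + U` which is INCOMING and, if the vorticity `Ω = curl U`
starts there at finite order `m`, RESONANT: `ν_i - Σ_k α_k ν_k = 1 + γ` for the spectrum `ν` of `∇V(y*)`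
(so `y*` is a saddle in the Siegel domain). The question left open in §4b of the note was whether the
profile equation imposes any FURTHER pointwise (Taylor-jet) constraint at such a node.

WHAT IS FORMALISED HERE (kernel-checked polynomial identities in `MvPolynomial (Fin 3) ℝ`, partial
derivatives = `MvPolynomial.pderiv`): for every order `m : ℕ` the explicit polynomial pair
    `U = (a₁ y₁, a₂ y₂ + s y₁^{m+1}, a₃ y₃)`, `P = q₁ y₁² + q₂ y₂² + q₃ y₃²`
solves (PE) exactly as soon as `2 q_k + a_k + a_k² = 0` and the single linear relation
`(1 - γ) + (m + 1)(γ + a₁) + a₂ = 0` holds (`shearGerm_profileResidual_eq_zero`); its divergence is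
`a₁ + a₂ + a₃` (`shearGerm_divergence`); its vorticity is `(0, 0, (m+1) s y₁^m)`
(`shearGerm_curl`), i.e. non-zero and of order exactly `m` at the node `y* = 0` when `s ≠ 0`; and in
the spectral variables `ν_k = γ + a_k` of `∇V(0) = diag(ν)` the two relations say precisely
`ν₃ - m ν₁ = 1 + γ` — the resonance `(Res_m)` of Theorem B with `i = 3`, `α = m e₁` — and
`ν₂ = 2γ - 1 - (m+1) ν₁` (`shearGerm_resonance`, `shearGerm_realises`). Consequently Theorem B's incoming
bound `ν_min ≤ -(1 - 2γ)/(m + 2)` is ATTAINED (`shearGerm_bound_iff`: on the resonance line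
`ν₁ ≤ ν₂ ↔ ν₁ ≤ -(1-2γ)/(m+2)`), and for `-(1+γ) < m ν₁`, `ν₁ < 0` the node is a genuine saddle
(`shearGerm_saddle`). The `m = 0` case (non-zero vorticity AT the node, [ConstantinIgnatovaVicol2026Euler]
Thm 3.8's setting) is realised by the LINEAR germ `U = (b₁ y₁ - w y₂, w y₁ + b₂ y₂, b₃ y₃)` with
`b₁ + b₂ = -1` (`linearVortexGerm_profileResidual_eq_zero`, vorticity `(0,0,2w)`, `linearVortexGerm_spectrum`).

MEANING (paper-level, §4c of the note): every resonant incoming saddle spectrum of type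
`ν_i - m ν_k = 1 + γ` is realised by an entire (polynomial) local solution of (PE) carrying vorticity of
order exactly `m` at the node. Hence NO further necessary condition on a window profile can be extracted
from the Taylor jet of (PE) at its vorticity-carrying node alone: Theorem B is sharp as a pointwise
statement, and any additional constraint must be GLOBAL (use decay / the Bernoulli confinement, as
Theorem A′ does). The germs are of course not profiles (no decay; `P` unbounded). Elementary; the examples
are the classical 'linear flow + parallel shear' exact solutions of Euler, transplanted to the self-similar
profile equation (searched: not found in [ConstantinIgnatovaVicol2026Euler] or elsewhere for (PE); claimed
only as a remark).
-/

namespace Summit.NavierStokesRegularity.NavierStokesRegularity.Theorems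

open MvPolynomial

noncomputable section

/-- Component `i` of the self-similar Euler profile operator (PE) applied to a polynomial pair `(U, P)` in
the three similarity variables `y₀, y₁, y₂` (indexed by `Fin 3`):
`(1 - γ) Uᵢ + Σₖ (γ yₖ + Uₖ) ∂ₖ Uᵢ + ∂ᵢ P`, partial derivatives being `MvPolynomial.pderiv`. -/
def profileResidual (γ : ℝ) (U : Fin 3 → MvPolynomial (Fin 3) ℝ) (P : MvPolynomial (Fin 3) ℝ)
    (i : Fin 3) : MvPolynomial (Fin 3) ℝ :=
  C (1 - γ) * U i + ((C γ * X 0 + U 0) * pderiv 0 (U i) + (C γ * X 1 + U 1) * pderiv 1 (U i) +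
    (C γ * X 2 + U 2) * pderiv 2 (U i)) + pderiv i P

/-- Divergence of a polynomial vector field. -/
def polyDiv (U : Fin 3 → MvPolynomial (Fin 3) ℝ) : MvPolynomial (Fin 3) ℝ :=
  pderiv 0 (U 0) + pderiv 1 (U 1) + pderiv 2 (U 2)

/-- The three components of the curl of a polynomial vector field. -/
def polyCurl₁ (U : Fin 3 → MvPolynomial (Fin 3) ℝ) : MvPolynomial (Fin 3) ℝ :=
  pderiv 1 (U 2) - pderiv 2 (U 1)
/-- see `polyCurl₁` -/
def polyCurl₂ (U : Fin 3 → MvPolynomial (Fin 3) ℝ) : MvPolynomial (Fin 3) ℝ :=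
  pderiv 2 (U 0) - pderiv 0 (U 2)
/-- see `polyCurl₁` -/
def polyCurl₃ (U : Fin 3 → MvPolynomial (Fin 3) ℝ) : MvPolynomial (Fin 3) ℝ :=
  pderiv 0 (U 1) - pderiv 1 (U 0)

/-- The nine first partial derivatives of the coordinate polynomials (bookkeeping for `simp only`). -/
private theorem dX :
    pderiv 0 (X 0 : MvPolynomial (Fin 3) ℝ) = 1 ∧ pderiv 0 (X 1 : MvPolynomial (Fin 3) ℝ) = 0 ∧
    pderiv 0 (X 2 : MvPolynomial (Fin 3) ℝ) = 0 ∧ pderiv 1 (X 0 : MvPolynomial (Fin 3) ℝ) = 0 ∧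
    pderiv 1 (X 1 : MvPolynomial (Fin 3) ℝ) = 1 ∧ pderiv 1 (X 2 : MvPolynomial (Fin 3) ℝ) = 0 ∧
    pderiv 2 (X 0 : MvPolynomial (Fin 3) ℝ) = 0 ∧ pderiv 2 (X 1 : MvPolynomial (Fin 3) ℝ) = 0 ∧
    pderiv 2 (X 2 : MvPolynomial (Fin 3) ℝ) = 1 :=
  ⟨pderiv_X_self 0, pderiv_X_of_ne (by decide), pderiv_X_of_ne (by decide), pderiv_X_of_ne (by decide),
    pderiv_X_self 1, pderiv_X_of_ne (by decide), pderiv_X_of_ne (by decide), pderiv_X_of_ne (by decide),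
    pderiv_X_self 2⟩

/-! ### The shear germ of order `m` (vorticity of order exactly `m` at the node) -/

/-- `U = (a₁ y₀, a₂ y₁ + s y₀^{m+1}, a₃ y₂)`. -/
def shearGermU (a₁ a₂ a₃ s : ℝ) (m : ℕ) : Fin 3 → MvPolynomial (Fin 3) ℝ :=
  ![C a₁ * X 0, C a₂ * X 1 + C s * X 0 ^ (m + 1), C a₃ * X 2]

/-- `P = q₁ y₀² + q₂ y₁² + q₃ y₂²`. -/
def diagQuadP (q₁ q₂ q₃ : ℝ) : MvPolynomial (Fin 3) ℝ :=
  C q₁ * X 0 ^ 2 + C q₂ * X 1 ^ 2 + C q₃ * X 2 ^ 2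

/-- The three components of `shearGermU`, by `rfl` (for rewriting under `simp only`). -/
private theorem shearGermU_apply (a₁ a₂ a₃ s : ℝ) (m : ℕ) :
    shearGermU a₁ a₂ a₃ s m 0 = C a₁ * X 0 ∧
    shearGermU a₁ a₂ a₃ s m 1 = C a₂ * X 1 + C s * X 0 ^ (m + 1) ∧
    shearGermU a₁ a₂ a₃ s m 2 = C a₃ * X 2 := ⟨rfl, rfl, rfl⟩

/-- **The shear germ solves (PE).** With pressure coefficients `2 q_k = -(a_k + a_k²)` and the single
linear relation `(1 - γ) + (m+1)(γ + a₁) + a₂ = 0` (the resonance, see `shearGerm_resonance`), all three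
components of the profile residual vanish identically. -/
theorem shearGerm_profileResidual_eq_zero {γ a₁ a₂ a₃ s q₁ q₂ q₃ : ℝ} {m : ℕ}
    (hq₁ : 2 * q₁ + a₁ + a₁ ^ 2 = 0) (hq₂ : 2 * q₂ + a₂ + a₂ ^ 2 = 0)
    (hq₃ : 2 * q₃ + a₃ + a₃ ^ 2 = 0) (hres : (1 - γ) + (m + 1) * (γ + a₁) + a₂ = 0) (i : Fin 3) :
    profileResidual γ (shearGermU a₁ a₂ a₃ s m) (diagQuadP q₁ q₂ q₃) i = 0 := by
  have Hq₁ : (2 : MvPolynomial (Fin 3) ℝ) * C q₁ + C a₁ + C a₁ ^ 2 = 0 := by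
    have h := congrArg (C : ℝ →+* MvPolynomial (Fin 3) ℝ) hq₁
    simpa [map_add, map_mul, map_pow, map_ofNat] using h
  have Hq₂ : (2 : MvPolynomial (Fin 3) ℝ) * C q₂ + C a₂ + C a₂ ^ 2 = 0 := by
    have h := congrArg (C : ℝ →+* MvPolynomial (Fin 3) ℝ) hq₂
    simpa [map_add, map_mul, map_pow, map_ofNat] using h
  have Hq₃ : (2 : MvPolynomial (Fin 3) ℝ) * C q₃ + C a₃ + C a₃ ^ 2 = 0 := by
    have h := congrArg (C : ℝ →+* MvPolynomial (Fin 3) ℝ) hq₃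
    simpa [map_add, map_mul, map_pow, map_ofNat] using h
  have Hres : ((1 : MvPolynomial (Fin 3) ℝ) - C γ) + ((m : MvPolynomial (Fin 3) ℝ) + 1) * (C γ + C a₁)
      + C a₂ = 0 := by
    have h := congrArg (C : ℝ →+* MvPolynomial (Fin 3) ℝ) hres
    simpa [map_add, map_sub, map_mul, map_natCast] using h
  obtain ⟨d00, d01, d02, d10, d11, d12, d20, d21, d22⟩ := dX
  obtain ⟨u0, u1, u2⟩ := shearGermU_apply a₁ a₂ a₃ s m
  have r0 : profileResidual γ (shearGermU a₁ a₂ a₃ s m) (diagQuadP q₁ q₂ q₃) 0 = 0 := by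
    simp only [profileResidual, u0, u1, u2, diagQuadP, map_add, map_sub, map_one,
      pderiv_mul, pderiv_pow, pderiv_C, d00, d01, d02, d10, d20]
    push_cast
    linear_combination (X 0 : MvPolynomial (Fin 3) ℝ) * Hq₁
  have r1 : profileResidual γ (shearGermU a₁ a₂ a₃ s m) (diagQuadP q₁ q₂ q₃) 1 = 0 := by
    simp only [profileResidual, u0, u1, u2, diagQuadP, map_add, map_sub, map_one,
      pderiv_mul, pderiv_pow, pderiv_C, d00, d01, d10, d11, d12, d20, d21, Nat.add_sub_cancel]
    push_cast
    linear_combination (X 1 : MvPolynomial (Fin 3) ℝ) * Hq₂ +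
      (C s * X 0 ^ (m + 1) : MvPolynomial (Fin 3) ℝ) * Hres
  have r2 : profileResidual γ (shearGermU a₁ a₂ a₃ s m) (diagQuadP q₁ q₂ q₃) 2 = 0 := by
    simp only [profileResidual, u0, u1, u2, diagQuadP, map_add, map_sub, map_one,
      pderiv_mul, pderiv_pow, pderiv_C, d02, d12, d20, d21, d22]
    push_cast
    linear_combination (X 2 : MvPolynomial (Fin 3) ℝ) * Hq₃
  fin_cases i
  exacts [r0, r1, r2]

/-- The divergence of the shear germ is the trace of the diagonal strain. -/
theorem shearGerm_divergence (a₁ a₂ a₃ s : ℝ) (m : ℕ) :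
    polyDiv (shearGermU a₁ a₂ a₃ s m) = C (a₁ + a₂ + a₃) := by
  obtain ⟨d00, -, -, d10, d11, -, -, -, d22⟩ := dX
  obtain ⟨u0, u1, u2⟩ := shearGermU_apply a₁ a₂ a₃ s m
  simp only [polyDiv, u0, u1, u2, map_add, pderiv_mul, pderiv_pow, pderiv_C, d00, d10, d11, d22]
  ring

/-- Vorticity of the shear germ: `(0, 0, (m+1) s y₀^m)` — non-zero iff `s ≠ 0`, vanishing at the node `0`
to order exactly `m`. -/
theorem shearGerm_curl (a₁ a₂ a₃ s : ℝ) (m : ℕ) :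
    polyCurl₁ (shearGermU a₁ a₂ a₃ s m) = 0 ∧ polyCurl₂ (shearGermU a₁ a₂ a₃ s m) = 0 ∧
      polyCurl₃ (shearGermU a₁ a₂ a₃ s m) = ((m : MvPolynomial (Fin 3) ℝ) + 1) * C s * X 0 ^ m := by
  obtain ⟨d00, d01, d02, d10, -, d12, d20, d21, -⟩ := dX
  obtain ⟨u0, u1, u2⟩ := shearGermU_apply a₁ a₂ a₃ s m
  refine ⟨?_, ?_, ?_⟩
  · simp only [polyCurl₁, u1, u2, map_add, pderiv_mul, pderiv_pow, pderiv_C, d12, d20, d21]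
    ring
  · simp only [polyCurl₂, u0, u2, pderiv_mul, pderiv_C, d02, d20]
    ring
  · simp only [polyCurl₃, u0, u1, map_add, pderiv_mul, pderiv_pow, pderiv_C, d00, d01, d10,
      Nat.add_sub_cancel]
    push_cast
    ring

/-- The similarity velocity `V = γ y + U` of the shear germ vanishes at the origin: `0` is a node. -/
theorem shearGerm_node (γ a₁ a₂ a₃ s : ℝ) (m : ℕ) :
    constantCoeff (C γ * X 0 + shearGermU a₁ a₂ a₃ s m 0) = 0 ∧
    constantCoeff (C γ * X 1 + shearGermU a₁ a₂ a₃ s m 1) = 0 ∧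
    constantCoeff (C γ * X 2 + shearGermU a₁ a₂ a₃ s m 2) = 0 := by
  obtain ⟨u0, u1, u2⟩ := shearGermU_apply a₁ a₂ a₃ s m
  refine ⟨?_, ?_, ?_⟩ <;>
    simp [u0, u1, u2, constantCoeff_X, constantCoeff_C, map_add, map_mul, map_pow]

/-- **Dictionary to Theorem B.** In the spectral variables `ν_k = γ + a_k` of `∇V(0) = diag(ν₁, ν₂, ν₃)`,
the two relations of the shear germ (trace-free strain and the shear compatibility) are exactly
`ν₁ + ν₂ + ν₃ = 3γ` together with the RESONANCE `ν₃ - m ν₁ = 1 + γ` of order `m` (`i = 3`, `α = m e₁`),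
and they force `ν₂ = 2γ - 1 - (m+1) ν₁`. -/
theorem shearGerm_resonance {γ a₁ a₂ a₃ ν₁ ν₂ ν₃ : ℝ} {m : ℕ} (hν₁ : ν₁ = γ + a₁) (hν₂ : ν₂ = γ + a₂)
    (hν₃ : ν₃ = γ + a₃) (hdiv : a₁ + a₂ + a₃ = 0) (hres : (1 - γ) + (m + 1) * (γ + a₁) + a₂ = 0) :
    ν₁ + ν₂ + ν₃ = 3 * γ ∧ ν₃ - m * ν₁ = 1 + γ ∧ ν₂ = 2 * γ - 1 - (m + 1) * ν₁ := by
  subst hν₁ hν₂ hν₃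
  refine ⟨by linarith, ?_, by linarith⟩
  linear_combination hdiv - hres

/-- Conversely every spectrum on the resonance line is realised: given `γ, ν₁` put
`a₁ = ν₁ - γ`, `a₂ = γ - 1 - (m+1) ν₁`, `a₃ = 1 + m ν₁`; then the two relations hold. -/
theorem shearGerm_realises (γ ν₁ : ℝ) (m : ℕ) :
    (ν₁ - γ) + (γ - 1 - (m + 1) * ν₁) + (1 + m * ν₁) = 0 ∧
      (1 - γ) + (m + 1) * (γ + (ν₁ - γ)) + (γ - 1 - (m + 1) * ν₁) = 0 := by
  constructor <;> ring

/-- **Theorem B's bound is attained.** On the resonance line (`ν₂ = 2γ - 1 - (m+1) ν₁`), `ν₁` is the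
smaller of the two in-plane rates iff `ν₁ ≤ -(1 - 2γ)/(m + 2)` — i.e. the incoming bound `(Inc_m)` of
`resonance_forces_incoming` holds with EQUALITY exactly at `ν₁ = ν₂`. -/
theorem shearGerm_bound_iff {γ ν₁ ν₂ : ℝ} {m : ℕ} (hν₂ : ν₂ = 2 * γ - 1 - (m + 1) * ν₁) :
    ν₁ ≤ ν₂ ↔ ν₁ ≤ -((1 - 2 * γ) / (m + 2)) := by
  have hm : (0 : ℝ) < (m : ℝ) + 2 := by positivity
  subst hν₂
  have e : -((1 - 2 * γ) / ((m : ℝ) + 2)) = (2 * γ - 1) / ((m : ℝ) + 2) := by ring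
  rw [e, le_div_iff₀ hm]
  constructor <;> intro h <;> linarith

/-- **The node is a saddle.** For `-(1+γ) < m ν₁` and `ν₁ < 0` the outgoing rate `ν₃ = 1 + γ + m ν₁` is
positive, so the spectrum `{ν₁ < 0 < ν₃}` lies in the Siegel domain. -/
theorem shearGerm_saddle {γ ν₁ ν₃ : ℝ} {m : ℕ} (hν₃ : ν₃ = 1 + γ + m * ν₁)
    (hlow : -(1 + γ) < m * ν₁) (hν₁ : ν₁ < 0) : ν₁ < 0 ∧ 0 < ν₃ := by
  refine ⟨hν₁, ?_⟩
  subst hν₃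
  linarith

/-- The window instance used in the note: `γ = 2/5`, `m = 1`, `ν = (-1/3, 7/15, 16/15)` — trace `6/5 = 3γ`,
resonance `ν₃ - ν₁ = 7/5 = 1 + γ`, `ν₂` on the resonance line, incoming rate `1/3 > (1-2γ)/3 = 1/15`. -/
example : (-1/3 : ℝ) + 7/15 + 16/15 = 3 * (2/5) ∧ (16/15 : ℝ) - 1 * (-1/3) = 1 + 2/5 ∧
    (7/15 : ℝ) = 2 * (2/5) - 1 - (1 + 1) * (-1/3) ∧ (1/15 : ℝ) < 1/3 := by norm_num

/-! ### The linear vortex germ (`m = 0`: non-zero vorticity at the node) -/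

/-- `U = (b₁ y₀ - w y₁, w y₀ + b₂ y₁, b₃ y₂)`: a linear strain plus a rigid rotation about `e₃`. -/
def linearVortexGermU (b₁ b₂ b₃ w : ℝ) : Fin 3 → MvPolynomial (Fin 3) ℝ :=
  ![C b₁ * X 0 - C w * X 1, C w * X 0 + C b₂ * X 1, C b₃ * X 2]

/-- The three components of `linearVortexGermU`, by `rfl` (for rewriting under `simp only`). -/
private theorem linearVortexGermU_apply (b₁ b₂ b₃ w : ℝ) :
    linearVortexGermU b₁ b₂ b₃ w 0 = C b₁ * X 0 - C w * X 1 ∧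
    linearVortexGermU b₁ b₂ b₃ w 1 = C w * X 0 + C b₂ * X 1 ∧
    linearVortexGermU b₁ b₂ b₃ w 2 = C b₃ * X 2 := ⟨rfl, rfl, rfl⟩

/-- **The linear vortex germ solves (PE)** as soon as `b₁ + b₂ = -1` (equivalently, with `div U = 0`,
`b₃ = 1`: the vorticity `2w e₃` is an eigenvector of `sym ∇U` with eigenvalue `1`,
[ConstantinIgnatovaVicol2026Euler] Thm 3.8's necessary condition) and `2 q₁ = w² - b₁ - b₁²`,
`2 q₂ = w² - b₂ - b₂²`, `2 q₃ = -(b₃ + b₃²)`. -/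
theorem linearVortexGerm_profileResidual_eq_zero {γ b₁ b₂ b₃ w q₁ q₂ q₃ : ℝ}
    (hb : b₁ + b₂ + 1 = 0) (hq₁ : 2 * q₁ + b₁ + b₁ ^ 2 - w ^ 2 = 0)
    (hq₂ : 2 * q₂ + b₂ + b₂ ^ 2 - w ^ 2 = 0) (hq₃ : 2 * q₃ + b₃ + b₃ ^ 2 = 0) (i : Fin 3) :
    profileResidual γ (linearVortexGermU b₁ b₂ b₃ w) (diagQuadP q₁ q₂ q₃) i = 0 := by
  have Hb : (C b₁ : MvPolynomial (Fin 3) ℝ) + C b₂ + 1 = 0 := by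
    have h := congrArg (C : ℝ →+* MvPolynomial (Fin 3) ℝ) hb
    simpa [map_add] using h
  have Hq₁ : (2 : MvPolynomial (Fin 3) ℝ) * C q₁ + C b₁ + C b₁ ^ 2 - C w ^ 2 = 0 := by
    have h := congrArg (C : ℝ →+* MvPolynomial (Fin 3) ℝ) hq₁
    simpa [map_add, map_sub, map_mul, map_pow, map_ofNat] using h
  have Hq₂ : (2 : MvPolynomial (Fin 3) ℝ) * C q₂ + C b₂ + C b₂ ^ 2 - C w ^ 2 = 0 := by
    have h := congrArg (C : ℝ →+* MvPolynomial (Fin 3) ℝ) hq₂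
    simpa [map_add, map_sub, map_mul, map_pow, map_ofNat] using h
  have Hq₃ : (2 : MvPolynomial (Fin 3) ℝ) * C q₃ + C b₃ + C b₃ ^ 2 = 0 := by
    have h := congrArg (C : ℝ →+* MvPolynomial (Fin 3) ℝ) hq₃
    simpa [map_add, map_mul, map_pow, map_ofNat] using h
  obtain ⟨d00, d01, d02, d10, d11, d12, d20, d21, d22⟩ := dX
  obtain ⟨u0, u1, u2⟩ := linearVortexGermU_apply b₁ b₂ b₃ w
  have r0 : profileResidual γ (linearVortexGermU b₁ b₂ b₃ w) (diagQuadP q₁ q₂ q₃) 0 = 0 := by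
    simp only [profileResidual, u0, u1, u2, diagQuadP, map_add, map_sub, map_one,
      pderiv_mul, pderiv_pow, pderiv_C, d00, d01, d02, d10, d11, d20, d21]
    push_cast
    linear_combination (X 0 : MvPolynomial (Fin 3) ℝ) * Hq₁ - (C w * X 1 : MvPolynomial (Fin 3) ℝ) * Hb
  have r1 : profileResidual γ (linearVortexGermU b₁ b₂ b₃ w) (diagQuadP q₁ q₂ q₃) 1 = 0 := by
    simp only [profileResidual, u0, u1, u2, diagQuadP, map_add, map_sub, map_one,
      pderiv_mul, pderiv_pow, pderiv_C, d00, d01, d10, d11, d12, d20, d21]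
    push_cast
    linear_combination (X 1 : MvPolynomial (Fin 3) ℝ) * Hq₂ + (C w * X 0 : MvPolynomial (Fin 3) ℝ) * Hb
  have r2 : profileResidual γ (linearVortexGermU b₁ b₂ b₃ w) (diagQuadP q₁ q₂ q₃) 2 = 0 := by
    simp only [profileResidual, u0, u1, u2, diagQuadP, map_add, map_sub, map_one,
      pderiv_mul, pderiv_pow, pderiv_C, d02, d12, d20, d21, d22]
    push_cast
    linear_combination (X 2 : MvPolynomial (Fin 3) ℝ) * Hq₃
  fin_cases i
  exacts [r0, r1, r2]

/-- The divergence of the linear vortex germ is `b₁ + b₂ + b₃` (so `b₃ = 1` under `b₁ + b₂ = -1`). -/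
theorem linearVortexGerm_divergence (b₁ b₂ b₃ w : ℝ) :
    polyDiv (linearVortexGermU b₁ b₂ b₃ w) = C (b₁ + b₂ + b₃) := by
  obtain ⟨d00, d01, -, d10, d11, -, -, -, d22⟩ := dX
  obtain ⟨u0, u1, u2⟩ := linearVortexGermU_apply b₁ b₂ b₃ w
  simp only [polyDiv, u0, u1, u2, map_add, map_sub, pderiv_mul, pderiv_C, d00, d01, d10, d11, d22]
  ring

/-- Its vorticity is the constant vector `(0, 0, 2w)`: non-zero AT the node (`m = 0`) when `w ≠ 0`. -/
theorem linearVortexGerm_curl (b₁ b₂ b₃ w : ℝ) :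
    polyCurl₁ (linearVortexGermU b₁ b₂ b₃ w) = 0 ∧ polyCurl₂ (linearVortexGermU b₁ b₂ b₃ w) = 0 ∧
      polyCurl₃ (linearVortexGermU b₁ b₂ b₃ w) = 2 * C w := by
  obtain ⟨d00, d01, d02, d10, d11, d12, d20, d21, -⟩ := dX
  obtain ⟨u0, u1, u2⟩ := linearVortexGermU_apply b₁ b₂ b₃ w
  refine ⟨?_, ?_, ?_⟩
  · simp only [polyCurl₁, u1, u2, map_add, pderiv_mul, pderiv_C, d12, d20, d21]
    ring
  · simp only [polyCurl₂, u0, u2, map_sub, pderiv_mul, pderiv_C, d02, d20, d21]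
    ring
  · simp only [polyCurl₃, u0, u1, map_add, map_sub, pderiv_mul, pderiv_C, d00, d01, d10, d11]
    ring

/-- Spectral reading of the `m = 0` germ: `∇V(0) = γ I + ∇U(0)` has the eigenvalue `γ + b₃ = 1 + γ` along the
vorticity and in-plane symmetric rates `γ + b₁, γ + b₂` summing to `2γ - 1` (negative for `γ < 1/2`) — the
node is incoming with rate `≥ (1 - 2γ)/2`, Theorem B's `(Inc_0)` (`caseA_incoming`), attained at
`b₁ = b₂ = -1/2`. -/
theorem linearVortexGerm_spectrum {γ b₁ b₂ b₃ : ℝ} (hb : b₁ + b₂ + 1 = 0) (hdiv : b₁ + b₂ + b₃ = 0) :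
    γ + b₃ = 1 + γ ∧ (γ + b₁) + (γ + b₂) = 2 * γ - 1 ∧ min (γ + b₁) (γ + b₂) ≤ -((1 - 2 * γ) / 2) := by
  refine ⟨by linarith, by linarith, ?_⟩
  rcases le_total b₁ b₂ with h | h
  · rw [min_eq_left (by linarith)]; linarith
  · rw [min_eq_right (by linarith)]; linarith

end

end Summit.NavierStokesRegularity.NavierStokesRegularity.Theorems
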